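import Summits.Ventures.LatticeQCDFlow.Scoring.WolffWindow

/-!
# The Madras–Sokal self-consistent window, typed: scorer A's cross-check scan and scorer B's window of record on set C-1

HONEST FRAMING: exact (Metropolis-corrected) sampling algorithms for lattice gauge theory;
figures of merit are autocorrelation/cost numbers at stated couplings and volumes; no
continuum-physics claim.

Venture `LatticeQCDFlow` (cell pub-lqcd), sub-topic `Scoring`; FANOUT row 11 (`eng-scorerA`).
NEW WORK of the cell (elementary), companion of `Scoring/WolffWindow.lean`.  The rule
`W*(c) = min {W ≥ 1 : W ≥ c · τ̂_W}` (Madras–Sokal, J. Stat. Phys. 50 (1988) 109, cited for the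
procedure only) is implemented twice in the frozen pair: scorer A `gamma.py` l.199–209 as the
CROSS-CHECK scan `tau_ms` (c ∈ {4, 6, 8, 10}; a disagreement with the automatic window raises
`window-underestimate`), and scorer B `scorer_b.py` `ms_window` l.139–146 as its WINDOW OF RECORD
(c = 6, FITNESS.md §A 'B: … Madras–Sokal window (c = 6)').  The A-vs-B acceptance test of the cell
('|τ_A − τ_B| ≤ 1 σ_comb on the calibration set') compares a Wolff-window τ̂ with an MS-window τ̂, so
what the two windows do to the SAME population curve is worth stating exactly.

## Content (population version on C-1, `ρ(t) = r^t`, `0 < r < 1`; `τ_W`, `τ_exp`, `relBias` as in `WolffWindow`)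

* `IsMSWindow c τW W` — the first `W ≥ 1` with `c · τW W ≤ W`; `isMSWindow_unique`.
* `exists_isMSWindow_geometric` — on the C-1 curve the MS window exists for every `c`, and
  `msWindow_le`: it is at most `⌈c · τ_int⌉₊ ⊔ 1` (any `W ≥ c τ_int` already satisfies the
  inequality because `τ_W < τ_int`, `tauIntWindow_lt_tauInt_geometric`).
* **`relBias_lt_of_isMSWindow`** — at an MS window the relative truncation bias is
  `< exp(−W/τ_exp) ≤ exp(−c · τ_W/τ_exp)`: the classic `e^{−c}`-type estimate, exactly, with the
  WINDOWED `τ_W` (what the code has in hand) in the exponent and `τ_exp` made explicit.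
* `msDTau`, `msDTau_eq_wolffDTau_drop`, `wolffDTau_le_msDTau` — scorer B's printed error
  `δτ_B = τ √((4W + 2)/N)` (scorer_b.py l.22) IS Wolff's leading-order `δτ_A = 2τ √((W + ½ − τ)/N)`
  (`CalibrationTruths.wolffDTau`, scorer A's `dtau_int`) with the `−τ` under the root dropped, hence
  `δτ_A ≤ δτ_B` at equal `(τ, W, N)`: of the two bars entering `σ_comb = √(δτ_A² + δτ_B²)`, B's is the
  conservative one by exactly that term (`msDTau_sq_sub_wolffDTau_sq`: `δτ_B² − δτ_A² = 4τ³/N`).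

NOT covered: noise; the `(1 + (2W+1)/N)` factor scorer A applies to its MS scan values (B1.1
convention) and B applies to its τ (Wolff eq. 49); binning/jackknife parts of scorer B.
-/

namespace Summit.Ventures.LatticeQCDFlow.Scoring

open scoped BigOperators
open Real

/-! ## The rule -/

/-- `W` is THE Madras–Sokal window of the curve `τW` at constant `c`: the first `W ≥ 1` with
`c · τ̂_W ≤ W` (scorer A gamma.py l.201–203 per `c`; scorer B `ms_window`). [ours] -/
def IsMSWindow (c : ℝ) (τW : ℕ → ℝ) (W : ℕ) : Prop :=
  1 ≤ W ∧ c * τW W ≤ W ∧ ∀ W', 1 ≤ W' → W' < W → (W' : ℝ) < c * τW W'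

/-- The MS window is unique (first crossing). -/
theorem isMSWindow_unique {c : ℝ} {τW : ℕ → ℝ} {W₁ W₂ : ℕ}
    (h₁ : IsMSWindow c τW W₁) (h₂ : IsMSWindow c τW W₂) : W₁ = W₂ := by
  rcases h₁ with ⟨h1a, h1b, h1c⟩
  rcases h₂ with ⟨h2a, h2b, h2c⟩
  by_contra hne
  rcases lt_or_gt_of_ne hne with hlt | hgt
  · exact absurd h1b (not_le.mpr (h2c W₁ h1a hlt))
  · exact absurd h2b (not_le.mpr (h1c W₂ h2a hgt))

/-! ## Existence and size on C-1 -/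

/-- On C-1 every `W ≥ c τ_int` (with `W ≥ 1`) satisfies the MS inequality, because `τ_W < τ_int`. -/
theorem ms_ineq_of_ge_tauInt {c r : ℝ} (hc : 0 ≤ c) (hr0 : 0 < r) (hr1 : r < 1) {W : ℕ}
    (hW : c * tauInt (fun t => r ^ t) ≤ W) :
    c * tauIntWindow (fun t => r ^ t) W ≤ W :=
  (mul_le_mul_of_nonneg_left (tauIntWindow_lt_tauInt_geometric hr0 hr1 W).le hc).trans hW

/-- **The MS window exists on C-1** for every `c ≥ 0`. -/
theorem exists_isMSWindow_geometric {c r : ℝ} (hc : 0 ≤ c) (hr0 : 0 < r) (hr1 : r < 1) :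
    ∃ W : ℕ, IsMSWindow c (fun W => tauIntWindow (fun t => r ^ t) W) W := by
  classical
  have hex : ∃ W : ℕ, 1 ≤ W ∧ c * tauIntWindow (fun t => r ^ t) W ≤ W := by
    refine ⟨max ⌈c * tauInt (fun t => r ^ t)⌉₊ 1, le_max_right _ _, ms_ineq_of_ge_tauInt hc hr0 hr1 ?_⟩
    exact (Nat.le_ceil _).trans (by exact_mod_cast le_max_left _ _)
  refine ⟨Nat.find hex, (Nat.find_spec hex).1, (Nat.find_spec hex).2, ?_⟩
  intro W' hW'1 hW'lt
  have hmin := Nat.find_min hex hW'lt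
  exact not_le.mp (fun h => hmin ⟨hW'1, h⟩)

/-- **Size**: the MS window on C-1 is at most `⌈c τ_int⌉₊ ⊔ 1` — it never waits past `c τ_int`. -/
theorem msWindow_le {c r : ℝ} (hc : 0 ≤ c) (hr0 : 0 < r) (hr1 : r < 1) {W : ℕ}
    (hW : IsMSWindow c (fun W => tauIntWindow (fun t => r ^ t) W) W) :
    W ≤ max ⌈c * tauInt (fun t => r ^ t)⌉₊ 1 := by
  by_contra hlt
  rw [not_le] at hlt
  have h := hW.2.2 (max ⌈c * tauInt (fun t => r ^ t)⌉₊ 1) (le_max_right _ _) hlt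
  have h2 : c * tauIntWindow (fun t => r ^ t) (max ⌈c * tauInt (fun t => r ^ t)⌉₊ 1)
      ≤ (max ⌈c * tauInt (fun t => r ^ t)⌉₊ 1 : ℕ) :=
    ms_ineq_of_ge_tauInt hc hr0 hr1 ((Nat.le_ceil _).trans (by exact_mod_cast le_max_left _ _))
  exact absurd h2 (not_le.mpr h)

/-- … and (trivially) at least `c τ_W` at its own window, i.e. `τ̂_W ≤ W/c` for `c > 0`. -/
theorem tauIntWindow_le_div_of_isMSWindow {c : ℝ} (hc : 0 < c) {τW : ℕ → ℝ} {W : ℕ}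
    (hW : IsMSWindow c τW W) : τW W ≤ W / c := by
  rw [le_div_iff₀ hc, mul_comm]
  exact hW.2.1

/-! ## The truncation bias at the MS window -/

/-- **At an MS window on C-1 the relative truncation bias is below `exp(−c τ_W/τ_exp)`** (and below
`exp(−W/τ_exp) = r^W` to begin with). -/
theorem relBias_lt_of_isMSWindow {c r : ℝ} (hr0 : 0 < r) (hr1 : r < 1) {W : ℕ}
    (hW : IsMSWindow c (fun W => tauIntWindow (fun t => r ^ t) W) W) :
    relBias (fun t => r ^ t) W < Real.exp (-(W : ℝ) / tauExp r) ∧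
      Real.exp (-(W : ℝ) / tauExp r)
        ≤ Real.exp (-(c * tauIntWindow (fun t => r ^ t) W) / tauExp r) := by
  have hτe := tauExp_pos hr0 hr1
  refine ⟨relBias_geometric_lt_exp hr0 hr1 W, ?_⟩
  rw [Real.exp_le_exp, neg_div, neg_div, neg_le_neg_iff]
  exact div_le_div_of_nonneg_right hW.2.1 hτe.le

/-- Numerically oriented corollary: with `c = 6` the bias at the MS window is below `exp(−6 τ_W/τ_exp)`;
on C-1 with `r` close to `1`, `τ_W ≈ τ_int ≈ τ_exp` and this is the textbook `e^{−6} ≈ 0.25 %`.  The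
exact relation between the two scales is `τ_int/τ_exp = τ_int · log(1/r) ∈ [(1+r)/2, (1+r)/(2r)]`: -/
theorem tauInt_div_tauExp_bounds {r : ℝ} (hr0 : 0 < r) (hr1 : r < 1) :
    (1 + r) / 2 ≤ tauInt (fun t => r ^ t) / tauExp r ∧
      tauInt (fun t => r ^ t) / tauExp r ≤ (1 + r) / (2 * r) := by
  have habs : |r| < 1 := abs_lt.mpr ⟨by linarith, hr1⟩
  have hl : 0 < Real.log (1 / r) := Real.log_pos (one_lt_one_div hr0 hr1)
  have h1r : 0 < 1 - r := by linarith
  -- τ_int/τ_exp = τ_int · log(1/r)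
  have hq : tauInt (fun t => r ^ t) / tauExp r = (1 + r) / (2 * (1 - r)) * Real.log (1 / r) := by
    rw [tauInt_geometric habs, tauExp]
    field_simp
  -- log bounds: 1 − r ≤ log(1/r) ≤ (1 − r)/r
  have hlo : 1 - r ≤ Real.log (1 / r) := by
    have := Real.add_one_le_exp (Real.log (1 / r))
    have h2 := Real.log_le_sub_one_of_pos hr0
    rw [one_div, Real.log_inv]
    linarith
  have hhi : Real.log (1 / r) ≤ (1 - r) / r := by
    have h2 := Real.log_le_sub_one_of_pos (by positivity : (0 : ℝ) < 1 / r)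
    have : (1 : ℝ) / r - 1 = (1 - r) / r := by field_simp
    linarith
  rw [hq]
  constructor
  · -- (1+r)/2 ≤ (1+r)/(2(1−r)) · log(1/r)  ⟸  (1 − r) ≤ log(1/r)
    have := mul_le_mul_of_nonneg_left hlo (by positivity : (0 : ℝ) ≤ (1 + r) / (2 * (1 - r)))
    calc (1 + r) / 2 = (1 + r) / (2 * (1 - r)) * (1 - r) := by field_simp
      _ ≤ (1 + r) / (2 * (1 - r)) * Real.log (1 / r) := this
  · have := mul_le_mul_of_nonneg_left hhi (by positivity : (0 : ℝ) ≤ (1 + r) / (2 * (1 - r)))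
    calc (1 + r) / (2 * (1 - r)) * Real.log (1 / r) ≤ (1 + r) / (2 * (1 - r)) * ((1 - r) / r) := this
      _ = (1 + r) / (2 * r) := by field_simp

/-! ## Scorer B's error bar is Wolff's with the `−τ` dropped -/

/-- Scorer B's printed error of its MS-window `τ̂` (scorer_b.py l.22, Madras–Sokal 1988):
`δτ_B = τ √((4W + 2)/N)`. -/
noncomputable def msDTau (τ W N : ℝ) : ℝ :=
  τ * Real.sqrt ((4 * W + 2) / N)

/-- `δτ_B = 2 τ √((W + ½)/N)` — Wolff's `δτ_A = 2τ √((W + ½ − τ)/N)` with the `−τ` dropped. -/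
theorem msDTau_eq (τ W N : ℝ) :
    msDTau τ W N = 2 * τ * Real.sqrt ((W + 1 / 2) / N) := by
  unfold msDTau
  have h4 : (4 * W + 2) / N = 4 * ((W + 1 / 2) / N) := by ring
  rw [h4, Real.sqrt_mul (by norm_num), show Real.sqrt 4 = 2 by
    rw [show (4 : ℝ) = 2 ^ 2 by norm_num, Real.sqrt_sq (by norm_num)]]
  ring

/-- Hence `δτ_A ≤ δτ_B` at equal `(τ, W, N)` with `τ ≥ 0`, `N > 0`. -/
theorem wolffDTau_le_msDTau {τ W N : ℝ} (hτ : 0 ≤ τ) (hN : 0 < N) :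
    wolffDTau τ W N ≤ msDTau τ W N := by
  rw [msDTau_eq τ W N, wolffDTau]
  refine mul_le_mul_of_nonneg_left (Real.sqrt_le_sqrt ?_) (by positivity)
  exact div_le_div_of_nonneg_right (by linarith) hN.le

/-- … by exactly the dropped term: `δτ_B² − δτ_A² = 4 τ³/N` whenever Wolff's radicand is
nonnegative (`τ ≤ W + ½`). -/
theorem msDTau_sq_sub_wolffDTau_sq {τ W N : ℝ} (hτ : 0 ≤ τ) (hN : 0 < N) (hW : τ ≤ W + 1 / 2) :
    msDTau τ W N ^ 2 - wolffDTau τ W N ^ 2 = 4 * τ ^ 3 / N := by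
  have h1 : 0 ≤ (W + 1 / 2) / N := div_nonneg (by linarith) hN.le
  have h2 : 0 ≤ (W + 1 / 2 - τ) / N := div_nonneg (by linarith) hN.le
  rw [msDTau_eq τ W N, wolffDTau]
  simp only [mul_pow, Real.sq_sqrt h1, Real.sq_sqrt h2]
  field_simp
  ring

end Summit.Ventures.LatticeQCDFlow.Scoring
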